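import Summits.BirchSwinnertonDyer.Rank1Residual.P2.ShuZhaiThirtySixCurve
import Summits.BirchSwinnertonDyer.Rank1Residual.P2.TransportAtTwo
import Literature.NumberTheory.EllipticCurves.KrizLi2019.TwoPartBSDTwists
import Literature.NumberTheory.EllipticCurves.LeadingTermTamagawaProofs
import Literature.NumberTheory.EllipticCurves.BurungaleSkinner2023.Curve14a1TwistsCertificate
import Literature.NumberTheory.EllipticCurves.Wang2016.SelmerRankTwoIffFourRankOne
import Summits.BirchSwinnertonDyer.Rank1Residual.Partition.CornersCMDecide
import HarnessLib

/-!
# Cell `bsd-print-cf2` (D-0131 (2) PRINT TIER, leaf CornerF @ `p = 2`), prover p3 — the curve `243a1`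
# (`= x³ + y³ = 9`) in the SETTING of Kriz–Li 2019 Thm 5.1 (2), every kernel-checkable hypothesis DISCHARGED

HONEST FRAMING. Companion of `P2/KrizLiTwoFortyThreeSlices.lean` (the BY-NAME SLICE of the W-ALL leaf
`Summit.BirchSwinnertonDyer.WAllCornerFTwo` — every CM curve of analytic rank one satisfies `BSD(E,2)` —
given by the Kriz–Li 2019 quadratic-twist family of `243a1`). The leaf is OPEN AS A CLASS; nothing
class-wide is closed; no named fact is introduced here; nothing is asserted beyond kernel theorems about
ONE explicit curve and one explicit quadratic field. Source of the setting: D. Kriz, C. Li, *Goldfeld's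
conjecture and congruences between Heegner points*, Forum Math. Sigma 7 (2019) e15 = arXiv:1606.03172
[KrizLi2019]: Thm 5.1 (2) (= arXiv Thm 1.12; tree `KrizLi2019.thm112_bsdTwo_twist`, typed verbatim by
sub-lane «bsd-p2») transports `BSD(2)` from `E`, `E^{(d_K)}` to `E^{(d)}`, `E^{(d·d_K)}` for `d ∈ 𝒩`,
`χ_d(−N) = 1`, for `E` with `E(ℚ)[2] = 0`, a Heegner field `K` with `2` split and Assumption (★),
`c₂(E)` odd; §6 Example 6.2 + Table 1 + Remark 6.3: "There is one CM elliptic curve in Table 1: namely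
`E = 243a1` with `j`-invariant `0`" (Table 1 = the rank-one optimal curves with `E(ℚ)[2] = 0`,
`N ≤ 300`, `K` of smallest `|d_K|` with the Heegner hypothesis and `2` split — for `N = 243 = 3⁵`
that is `K = ℚ(√−23)` — and a check-mark when (★) holds).

DISCHARGED IN THE KERNEL here, for Cremona's globally minimal model `E = 243a1 = [0,0,1,0,−1]`
(`y² + y = x³ − 1`, `Δ = −3⁵`, `c₄ = 0`, `j = 0`: CM by `ℤ[ζ₃]`, `2` INERT in `K_CM = ℚ(√−3)` and
good supersingular at `2`): `E` elliptic and globally minimal; `E(ℚ)[2] = 0` (no affine `2`-torsion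
point modulo the good prime `13` — `x³ = 4` has no root in `𝔽₁₃` — and injectivity of reduction on
prime-to-`13` torsion, tree `Rank2Observatory.eq_zero_of_reduceMod_eq_zero`); `N_E ∣ 243` (Ogg's bound,
tree `conductorNorm_dvd_of_localBounds`; Cremona: `N = 243`, not needed); good reduction at `2` and
`c₂(E) = 1` (tree `localTamagawaNumber_padic_eq_one_of_good_holds`); for any imaginary quadratic `K`
with `d_K = −23`: the Heegner hypothesis for `N_E` (`(−23/3) = 1`) and `2` split (`−23 ≡ 1 (mod 8)`);
the tree's `ℚ(√−23) = sqrtField (−23)` is such a `K`; and the membership `d ∈ 𝒩` (Kriz–Li Def 4.1,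
`KrizLi2019.InN`) from EXPLICIT congruence conditions on the prime factors of `d`. The curve is the
cube-sum curve `C₉ : x³ + y³ = 9` (`1³ + 2³ = 9`; Dasgupta–Voight 2018 §1: "The elliptic curve `E₉` of
conductor `243` is number `243a1` in the tables of Cremona"), generator `(1, 0)`, rank `1`.

References: [KrizLi2019] Thm 5.1, Def 4.1, §6 Example 6.2, Table 1, Remark 6.3 (FMS VoR pp. 27–36;
arXiv:1606.03172 chunk p0019 L41–L44); [Cremona1997] Table 1 (243a1); [SilvermanAEC2009] VII.1 Rem 1.1,
VII.3.1(b); [Silverman1994] IV.11.1; [Marcus1977] Ch. 3 Thm 25; [DasguptaVoight2018] §1.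
-/

noncomputable section

open scoped Classical

open WeierstrassCurve NumberField Literature.NumberTheory.EllipticCurves
  Literature.NumberTheory.EllipticCurves.Rank1Residual
  Literature.NumberTheory.EllipticCurves.ModularForms
  Literature.NumberTheory.EllipticCurves.Rank1Residual.X11RankOneCertificates
  Summit.BirchSwinnertonDyer.Rank1Residual
  Summit.BirchSwinnertonDyer.BirchSwinnertonDyer.Theorems.ConductorBoundOfBadPrimes

set_option autoImplicit false

namespace Summit.BirchSwinnertonDyer.Rank1Residual.P2

/-! ## §1 The curve `243a1` -/

/-- **Cremona's `243a1 = [0,0,1,0,−1]`**: `E : y² + y = x³ − 1` (`= x³ + y³ = 9` after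
`8y + 4 = Y`, `4x = X`: `Y² = X³ − 48`); `Δ = −243 = −3⁵`, `c₄ = 0` (`j = 0`, CM by `ℤ[ζ₃]`).
[cite: Cremona1997, Table 1 (curve 243a1)] -/
def curve243a1 : WeierstrassCurve ℚ := ⟨0, 0, 1, 0, -1⟩

/-- The integer model of `243a1`. [cite: Cremona1997, Table 1 (curve 243a1)] -/
def curve243a1Int : WeierstrassCurve ℤ := ⟨0, 0, 1, 0, -1⟩

/-- The integer model maps to the rational one. [folklore] -/
theorem curve243a1Int_map : curve243a1Int.map (Int.castRingHom ℚ) = curve243a1 := by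
  ext <;> simp [curve243a1Int, curve243a1, WeierstrassCurve.map]

/-- The integer model base-changes to the rational one. [folklore] -/
theorem curve243a1Int_baseChange : curve243a1Int.baseChange ℚ = curve243a1 := by
  ext <;> simp [curve243a1Int, curve243a1, WeierstrassCurve.baseChange, WeierstrassCurve.map]

/-- `Δ(E) = −243 = −3⁵`. [folklore] -/
theorem curve243a1_Δ : curve243a1.Δ = -243 := by
  simp only [curve243a1, WeierstrassCurve.Δ, WeierstrassCurve.b₂, WeierstrassCurve.b₄, WeierstrassCurve.b₆,
    WeierstrassCurve.b₈]
  norm_num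

/-- `Δ` of the integer model is `−243`. [folklore] -/
theorem curve243a1Int_Δ : curve243a1Int.Δ = -243 := by
  simp only [curve243a1Int, WeierstrassCurve.Δ, WeierstrassCurve.b₂, WeierstrassCurve.b₄, WeierstrassCurve.b₆,
    WeierstrassCurve.b₈]
  norm_num

/-- `c₄(E) = 0` (so `j(E) = 0`). [folklore] -/
theorem curve243a1_c₄ : curve243a1.c₄ = 0 := by
  simp only [curve243a1, WeierstrassCurve.c₄, WeierstrassCurve.b₂, WeierstrassCurve.b₄]
  norm_num

/-- `E` is an elliptic curve (`Δ ≠ 0`). [folklore] -/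
instance isElliptic_curve243a1 : curve243a1.IsElliptic :=
  X11b.isElliptic_of_discOf_ne_zero 0 0 1 0 (-1) (by decide +kernel)

/-- **`E = [0,0,1,0,−1]` is globally minimal** (`|Δ| = 3⁵`: `q¹² ∤ Δ` at every prime).
[cite: SilvermanAEC2009, VII.1 Remark 1.1] -/
instance isGloballyMinimal_curve243a1 : curve243a1.IsGloballyMinimal :=
  X11b.isGloballyMinimal_of_krausCriterion_support 0 0 1 0 (-1) [(3, 5, 5)]
    (by intro t ht; simp only [List.mem_cons, List.not_mem_nil, or_false] at ht; rcases ht with rfl; norm_num)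
    (by decide +kernel) (by decide +kernel)

/-- `j(E) = 0`. [folklore] -/
theorem curve243a1_j : curve243a1.j = 0 := by
  rw [WeierstrassCurve.j, curve243a1_c₄]
  simp

/-- **`E` has complex multiplication** (`j = 0`: CM by `ℤ[ζ₃]`). [cite: SilvermanAEC2009, Appendix C §11, Example 11.3.1] -/
theorem hasCM_curve243a1 : curve243a1.HasCM :=
  hasCM_of_j_eq_zero _ curve243a1_j

/-- **`2` is inert in the CM field of `E`** (`K_CM = ℚ(√−3)`, `d = −3 ≡ 5 (mod 8)`). [cite: Cox2013, §5.B Prop. 5.16] -/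
theorem cmInert_two_curve243a1 : CMInert curve243a1 2 :=
  (cmInert_two_iff_of_hasCM hasCM_curve243a1).2 (Or.inl (by rw [curve243a1_j]; simp [cmFieldDiscrOfJ]))

/-- `(1, 0) ∈ E(ℚ)` — the point `1³ + 2³ = 9` of the cube-sum model; a generator of `E(ℚ) ≅ ℤ`
(Cremona), not needed below. [cite: Cremona1997, Table 1 (curve 243a1)] -/
theorem equation_curve243a1_one_zero : curve243a1.toAffine.Equation 1 0 := by
  rw [WeierstrassCurve.Affine.equation_iff]
  norm_num [curve243a1]

/-! ## §2 `E(ℚ)[2] = 0`: no rational `2`-torsion (reduction modulo the good prime `13`) -/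

/-- Boolean: `Ẽ(𝔽_q)` has NO affine point `(β, γ)` with `2γ + a₁β + a₃ = 0`, i.e. no non-zero
`2`-torsion point (for `V = 243a1`, `q = 13`: `γ = 6`, `β³ = 4` has no solution — the cubes of `𝔽₁₃`
are `{0, ±1, ±5}`). [cite: SilvermanAEC2009, III.2.3] -/
def twoTorsionNoneB (V : WeierstrassCurve ℤ) (q : ℕ) [NeZero q] : Bool :=
  decide (∀ β γ : ZMod q,
    γ ^ 2 + (V.a₁ : ZMod q) * β * γ + (V.a₃ : ZMod q) * γ =
      β ^ 3 + (V.a₂ : ZMod q) * β ^ 2 + (V.a₄ : ZMod q) * β + (V.a₆ : ZMod q) →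
    2 * γ + (V.a₁ : ZMod q) * β + (V.a₃ : ZMod q) ≠ 0)

/-- Soundness of `twoTorsionNoneB` in `Ẽ(𝔽_q)`: a point `z` with `2 • z = 0` is `O`.
[cite: SilvermanAEC2009, III.2.3] -/
theorem eq_zero_of_twoTorsionNoneB (V : WeierstrassCurve ℤ) (q : ℕ) [Fact q.Prime]
    (h1 : twoTorsionNoneB V q = true)
    (z : (V.map (Int.castRingHom (ZMod q))).toAffine.Point) (hz : 2 • z = 0) : z = 0 := by
  classical
  simp only [twoTorsionNoneB, decide_eq_true_eq] at h1
  rcases z with _ | ⟨β, γ, hns⟩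
  · rfl
  · exfalso
    have ha₁ : (V.map (Int.castRingHom (ZMod q))).a₁ = (V.a₁ : ZMod q) := by simp [WeierstrassCurve.map]
    have ha₂ : (V.map (Int.castRingHom (ZMod q))).a₂ = (V.a₂ : ZMod q) := by simp [WeierstrassCurve.map]
    have ha₃ : (V.map (Int.castRingHom (ZMod q))).a₃ = (V.a₃ : ZMod q) := by simp [WeierstrassCurve.map]
    have ha₄ : (V.map (Int.castRingHom (ZMod q))).a₄ = (V.a₄ : ZMod q) := by simp [WeierstrassCurve.map]
    have ha₆ : (V.map (Int.castRingHom (ZMod q))).a₆ = (V.a₆ : ZMod q) := by simp [WeierstrassCurve.map]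
    have heq : γ ^ 2 + (V.a₁ : ZMod q) * β * γ + (V.a₃ : ZMod q) * γ =
        β ^ 3 + (V.a₂ : ZMod q) * β ^ 2 + (V.a₄ : ZMod q) * β + (V.a₆ : ZMod q) := by
      have e := (Affine.equation_iff β γ).mp hns.left
      rwa [ha₁, ha₂, ha₃, ha₄, ha₆] at e
    rw [two_nsmul] at hz
    have hneg : Affine.Point.some β γ hns = -Affine.Point.some β γ hns := eq_neg_of_add_eq_zero_left hz
    rw [Affine.Point.neg_some, Affine.Point.some.injEq] at hneg
    have h2t : 2 * γ + (V.a₁ : ZMod q) * β + (V.a₃ : ZMod q) = 0 := by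
      have hγ := hneg.2
      rw [Affine.negY, ha₁, ha₃] at hγ
      linear_combination hγ
    exact h1 β γ heq h2t

open BirchSwinnertonDyer.Rank2Observatory in
/-- **No rational `2`-torsion from one good odd prime**: if `q ∤ Δ(V)`, `q` odd, and `Ẽ(𝔽_q)` has no
non-zero `2`-torsion point (`twoTorsionNoneB`), then `E(ℚ)[2] = 0` (reduction is injective on
prime-to-`q` torsion). [cite: SilvermanAEC2009, Prop. VII.3.1(b)] -/
theorem twoTorsion_eq_zero_of_twoTorsionNoneB (V : WeierstrassCurve ℤ) (q : ℕ) [Fact q.Prime]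
    (hq : ¬ (q : ℤ) ∣ V.Δ) (hodd : q ≠ 2) (h1 : twoTorsionNoneB V q = true)
    (w : (V.map (Int.castRingHom ℚ)).toAffine.Point) (h : 2 • w = 0) : w = 0 := by
  have hn : ¬ q ∣ 2 := fun hd =>
    hodd ((Nat.prime_dvd_prime_iff_eq (Fact.out : q.Prime) Nat.prime_two).mp hd)
  refine eq_zero_of_reduceMod_eq_zero V q hq w hn h ?_
  exact eq_zero_of_twoTorsionNoneB V q h1 _ (by rw [← map_nsmul, h, map_zero])

/-- **`E(ℚ)[2] = 0` for `E = 243a1`** (Kriz–Li's standing hypothesis "`E(ℚ)[2] = 0`", in the tree's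
shape `∀ Q, 2 • Q = 0 → Q = 0`): modulo the good prime `13` there is no affine `2`-torsion point.
[cite: KrizLi2019, Thm. 5.1 hypothesis "E(ℚ)[2] = 0" and Example 6.2] [cite: SilvermanAEC2009, Prop. VII.3.1(b)] -/
theorem twoTorsion_curve243a1 : ∀ Q : curve243a1.toAffine.Point, 2 • Q = 0 → Q = 0 := by
  rw [← curve243a1Int_map]
  haveI : Fact (Nat.Prime 13) := ⟨by norm_num⟩
  have hΔ : ¬ ((13 : ℕ) : ℤ) ∣ curve243a1Int.Δ := by rw [curve243a1Int_Δ]; norm_num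
  have hB : twoTorsionNoneB curve243a1Int 13 = true := by decide +kernel
  exact fun Q hQ => twoTorsion_eq_zero_of_twoTorsionNoneB curve243a1Int 13 hΔ (by norm_num) hB Q hQ

/-! ## §3 The conductor: `N_E ∣ 243`, so `N_E = 3ᵏ` and the primes of `2N_E` are among `{2, 3}` -/

/-- **`N(E) ∣ 243 = 3⁵` — IN THE KERNEL** (Ogg's `f_q ≤ ord_q Δ_min`; here `3⁵ ∥ Δ`; Cremona: `N = 243`
exactly, not needed). [cite: Silverman1994, IV.11.1] [cite: Cremona1997, Table 1 (243a1)] -/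
theorem conductorNorm_curve243a1_dvd : curve243a1.conductorNorm ℤ ∣ 243 :=
  conductorNorm_dvd_of_localBounds 0 0 1 0 (-1) curve243a1 rfl [(3, 5)]
    (by intro t ht; simp only [List.mem_cons, List.not_mem_nil, or_false] at ht; rcases ht with rfl; norm_num)
    (by decide +kernel) (by norm_num) (by decide +kernel)

/-- `N(E) = 3ᵏ` for some `k ≤ 5`. [folklore] -/
theorem conductorNorm_curve243a1_eq_pow : ∃ k ≤ 5, curve243a1.conductorNorm ℤ = 3 ^ k :=
  (Nat.dvd_prime_pow Nat.prime_three).1 conductorNorm_curve243a1_dvd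

/-- `N(E) ≠ 0` (instance used by the parametrisation datum at level `N`). [folklore] -/
instance neZero_conductorNorm_curve243a1 : NeZero (curve243a1.conductorNorm ℤ) :=
  ⟨(curve243a1.conductorNorm_pos_holds).ne'⟩

/-- A prime `ℓ ∉ {2, 3}` does not divide `2N(E)` (`2N(E) ∣ 2·3⁵`). [folklore] -/
theorem not_dvd_two_mul_conductorNorm_curve243a1 {ℓ : ℕ} (hℓ : ℓ.Prime) (h2 : ℓ ≠ 2) (h3 : ℓ ≠ 3) :
    ¬ ℓ ∣ 2 * curve243a1.conductorNorm ℤ := by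
  intro h
  have h' : ℓ ∣ 2 * 243 := h.trans (mul_dvd_mul_left 2 conductorNorm_curve243a1_dvd)
  rcases (Nat.Prime.dvd_mul hℓ).mp h' with h | h
  · exact h2 ((Nat.prime_dvd_prime_iff_eq hℓ Nat.prime_two).mp h)
  · exact h3 ((Nat.prime_dvd_prime_iff_eq hℓ Nat.prime_three).mp
      (hℓ.dvd_of_dvd_pow (show ℓ ∣ 3 ^ 5 by simpa using h)))

/-! ## §4 At the prime `2`: good (supersingular) reduction, `c₂(E) = 1` -/

/-- **`E` has good reduction at `2`** (`2 ∤ Δ = −243`). [cite: SilvermanAEC2009, VII.5 Prop. 5.1(a)] -/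
theorem hasGoodReductionAtPrime_two_curve243a1 :
    haveI : Fact (2 : ℕ).Prime := ⟨Nat.prime_two⟩
    curve243a1.HasGoodReductionAtPrime 2 := by
  haveI : Fact (2 : ℕ).Prime := ⟨Nat.prime_two⟩
  haveI : (curve243a1Int.baseChange ℚ).IsElliptic := by rw [curve243a1Int_baseChange]; infer_instance
  have h := BurungaleSkinner2023.hasGoodReductionAtPrime_baseChange_int_of_not_dvd curve243a1Int (p := 2)
    (by rw [curve243a1Int_Δ]; norm_num)
  rwa [curve243a1Int_baseChange] at h

/-- **`c₂(E) = 1`** (good reduction at `2`: `E₀(ℚ₂) = E(ℚ₂)`). [cite: SilvermanAEC2009, VII.2 (remark after Prop. 2.1)] -/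
theorem localTamagawaNumber_two_curve243a1 :
    haveI : Fact (2 : ℕ).Prime := ⟨Nat.prime_two⟩
    (curve243a1.baseChange ℚ_[2]).localTamagawaNumber ℤ_[2] = 1 :=
  localTamagawaNumber_padic_eq_one_of_good_holds curve243a1 2 hasGoodReductionAtPrime_two_curve243a1

/-- **Kriz–Li's local hypotheses at `2` for `E = 243a1`**: `c₂(E)` is odd, and the Manin-constant
clause ("if `E` has additive reduction at `2` …") is vacuous since `E` has good reduction at `2`.
[cite: KrizLi2019, Thm. 5.1 hypotheses "c₂(E) odd; Manin constant odd if additive at 2"] -/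
theorem krizLi_loc_curve243a1 (Dt : ModularParametrizationData curve243a1 (curve243a1.conductorNorm ℤ)) :
    haveI : Fact (2 : ℕ).Prime := ⟨Nat.prime_two⟩
    Odd ((curve243a1.baseChange ℚ_[2]).localTamagawaNumber ℤ_[2]) ∧
      (¬ curve243a1.HasGoodReductionAtPrime 2 → ¬ curve243a1.HasMultiplicativeReductionAtPrime 2 → Odd Dt.c) :=
  ⟨by rw [localTamagawaNumber_two_curve243a1]; exact odd_one,
    fun h _ => absurd hasGoodReductionAtPrime_two_curve243a1 h⟩

/-! ## §5 The Heegner field `K = ℚ(√−23)`: `d_K = −23`, `2` and `3` split -/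

/-- **`F = ℚ(√−p)` is imaginary quadratic of discriminant `−p`** for `p ≡ 3 (mod 4)` prime and `F` a
quadratic number field containing `x` with `x² = −p` (`θ = (1 + x)/2` is a root of `X² − X + (p+1)/4`).
[cite: Marcus1977, Ch. 2 Thm. 1] -/
theorem isImaginaryQuadratic_and_discr_of_sq_eq_neg_prime {F : Type} [Field F] [NumberField F]
    (h2 : Module.finrank ℚ F = 2) {p : ℕ} (hp : p.Prime) (hp4 : p % 4 = 3) {x : F}
    (hx : x ^ 2 = ((-(p : ℤ) : ℤ) : F)) :
    IsImaginaryQuadratic F ∧ NumberField.discr F = -(p : ℤ) := by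
  obtain ⟨k, hk⟩ : ∃ k : ℤ, (p : ℤ) + 1 = 4 * k := ⟨(p + 1) / 4, by omega⟩
  have hd : (-1 : ℤ) ^ 2 - 4 * k = -(p : ℤ) := by linear_combination hk
  have hkF : ((p : ℤ) : F) + 1 = 4 * (k : F) := by exact_mod_cast congrArg (fun z : ℤ => (z : F)) hk
  have hx' : x ^ 2 = -((p : ℤ) : F) := by rw [hx]; push_cast; ring
  have hrel : ((1 + x) / 2) ^ 2 + ((-1 : ℤ) : F) * ((1 + x) / 2) + ((k : ℤ) : F) = 0 := by
    have key : ((1 + x) / 2) ^ 2 + ((-1 : ℤ) : F) * ((1 + x) / 2) + ((k : ℤ) : F) =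
        (x ^ 2 - 1 + 4 * (k : F)) / 4 := by
      push_cast
      field_simp
      ring
    rw [key, hx', ← hkF]
    ring
  obtain ⟨htc, hdisc⟩ := isTotallyComplex_and_discr_eq_neg_of_root h2 hp hd hrel
  exact ⟨⟨h2, htc⟩, hdisc⟩

/-- `−23 < 0` (the `Fact` making `sqrtField (−23) = ℚ[X]/(X² + 23)` a field). [folklore] -/
instance fact_neg_twentyThree_lt_zero : Fact ((-23 : ℤ) < 0) := ⟨by norm_num⟩

/-- **The tree's `ℚ(√−23) = sqrtField (−23)` is imaginary quadratic with `d_K = −23`.**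
[cite: Marcus1977, Ch. 2 Thm. 1] -/
theorem isImaginaryQuadratic_and_discr_sqrtField_neg_twentyThree :
    IsImaginaryQuadratic (sqrtField (-23)) ∧ NumberField.discr (sqrtField (-23)) = -23 :=
  isImaginaryQuadratic_and_discr_of_sq_eq_neg_prime (sqrtField.finrank_eq_two (-23))
    (p := 23) (by norm_num) (by norm_num) (x := sqrtField.r (-23)) (by rw [sqrtField.r_sq']; push_cast; ring)

/-- **A prime `ℓ` with `(−23/ℓ) = 1`, `ℓ ≠ 2`, splits in any quadratic `K` with `d_K = −23`** (two primes
of `𝓞 K` above `ℓ`; decomposition law). [cite: Marcus1977, Ch. 3 Thm. 25] -/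
theorem ncard_primesOver_eq_two_of_discr_eq {K : Type} [Field K] [NumberField K]
    (h2 : Module.finrank ℚ K = 2) (hdK : NumberField.discr K = -23) {ℓ : ℕ} (hℓ : ℓ.Prime) (hℓ2 : ℓ ≠ 2)
    (hj : jacobiSym (-23) ℓ = 1) : ((Ideal.span {(ℓ : ℤ)}).primesOver (𝓞 K)).ncard = 2 := by
  rw [Literature.NumberTheory.QuadraticFields.Quadratic.ncard_primesOver_eq_two_iff_jacobiSym h2 hℓ hℓ2, hdK]
  exact hj

/-- **`2` splits in any quadratic `K` with `d_K = −23`** (`−23 ≡ 1 (mod 8)`). [cite: Marcus1977, Ch. 3 Thm. 25] -/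
theorem ncard_primesOver_two_eq_two_of_discr_eq {K : Type} [Field K] [NumberField K]
    (h2 : Module.finrank ℚ K = 2) (hdK : NumberField.discr K = -23) :
    ((Ideal.span {(2 : ℤ)}).primesOver (𝓞 K)).ncard = 2 := by
  rw [Literature.NumberTheory.QuadraticFields.Quadratic.ncard_primesOver_two_eq_two_iff h2, hdK]
  decide

/-- **The Heegner hypothesis of Thm 5.1 for `(243a1, K)`, `d_K = −23`: every prime of `N(E)` splits in
`K`** (`N ∣ 3⁵` and `(−23/3) = (1/3) = 1`). [cite: KrizLi2019, Thm. 5.1 hypothesis "K satisfies the Heegner hypothesis for N"]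
[cite: Marcus1977, Ch. 3 Thm. 25] -/
theorem satisfiesHeegnerHypothesis_curve243a1 {K : Type} [Field K] [NumberField K]
    (h2 : Module.finrank ℚ K = 2) (hdK : NumberField.discr K = -23) :
    SatisfiesHeegnerHypothesis (curve243a1.conductorNorm ℤ) K := by
  have h243 : SatisfiesHeegnerHypothesis (3 ^ 5) K := by
    rw [satisfiesHeegnerHypothesis_iff_kronecker _ K h2, hdK]
    intro q hq hqN
    obtain rfl := (Nat.prime_dvd_prime_iff_eq hq Nat.prime_three).mp (hq.dvd_of_dvd_pow hqN)
    refine ⟨fun h => absurd h (by norm_num), fun _ => ?_⟩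
    have hmod : (-23 : ℤ) % ((3 : ℕ) : ℤ) = 1 % ((3 : ℕ) : ℤ) := by decide
    rw [jacobiSym.mod_left, hmod, ← jacobiSym.mod_left, jacobiSym.one_left]
  exact h243.of_dvd (by simpa using conductorNorm_curve243a1_dvd)

/-! ## §6 The index set `𝒩` of Kriz–Li Def 4.1 for `(243a1, ℚ(√−23))`, from explicit congruences -/

/-- **An EXPLICIT sufficient condition for `ℓ ∈ 𝒮`** (Kriz–Li Def 4.1 at `E = 243a1`, `K = ℚ(√−23)`):
`ℓ` prime, `ℓ ∉ {2, 3}` (`⟺ ℓ ∤ 2N`), `(−23/ℓ) = 1` (`ℓ` splits in `K`) and `a_ℓ(E)` odd (Frobenius of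
order `3` on `E[2]`). (For this curve `a_ℓ` odd forces `ℓ ≡ 1 (mod 3)` and `6` a non-cube mod `ℓ`:
`𝒮 = {13, 31, 73, 127, 151, 193, 211, 223, 271, 277, …}`, evidence job j282198.)
[cite: KrizLi2019, Def. 4.1 (FMS) = arXiv Def. 3.1] -/
def IsKrizLiPrime243 (ℓ : ℕ) : Prop :=
  ℓ.Prime ∧ ℓ ≠ 2 ∧ ℓ ≠ 3 ∧ jacobiSym (-23) ℓ = 1 ∧ Odd (curve243a1.frobeniusTrace ℓ)

/-- **`ℓ ∈ 𝒮`** for such `ℓ`, in any quadratic `K` with `d_K = −23`. [cite: KrizLi2019, Def. 4.1 (FMS) = arXiv Def. 3.1] -/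
theorem inS_curve243a1 {K : Type} [Field K] [NumberField K] (h2 : Module.finrank ℚ K = 2)
    (hdK : NumberField.discr K = -23) {ℓ : ℕ} (h : IsKrizLiPrime243 ℓ) : KrizLi2019.InS curve243a1 K ℓ :=
  ⟨h.1, not_dvd_two_mul_conductorNorm_curve243a1 h.1 h.2.1 h.2.2.1,
    ncard_primesOver_eq_two_of_discr_eq h2 hdK h.1 h.2.1 h.2.2.2.1, h.2.2.2.2⟩

/-- **`d ∈ 𝒩`** (Kriz–Li Def 4.1: `d ≡ 1 (mod 4)`, `|d|` a square-free product of primes in `𝒮`) from the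
explicit conditions on the prime factors, in any quadratic `K` with `d_K = −23`.
[cite: KrizLi2019, Def. 4.1 (FMS) = arXiv Def. 3.1] -/
theorem inN_curve243a1 {K : Type} [Field K] [NumberField K] (h2 : Module.finrank ℚ K = 2)
    (hdK : NumberField.discr K = -23) {d : ℤ} (hd4 : d % 4 = 1) (hsq : Squarefree d.natAbs)
    (hprimes : ∀ ℓ : ℕ, ℓ.Prime → ℓ ∣ d.natAbs → IsKrizLiPrime243 ℓ) : KrizLi2019.InN curve243a1 K d :=
  ⟨hd4, hsq, fun ℓ hℓ hℓd => inS_curve243a1 h2 hdK (hprimes ℓ hℓ hℓd)⟩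

/-- **The sign condition `χ_d(−N) = 1` for POSITIVE `d ≡ 1 (mod 12)`**, whatever the exact power
`N(E) = 3ᵏ` is: `sgn(d)·(N/d) = (3/d)ᵏ = (d/3)ᵏ = 1` (reciprocity for `d ≡ 1 (mod 4)`, `d ≡ 1 (mod 3)`).
(For `d ∈ 𝒩` negative the condition also holds in print, since `N = 3⁵` exactly — Cremona — but the
kernel only knows `N ∣ 3⁵`, so negative `d` are carried with the condition as printed.)
[cite: KrizLi2019, Thm. 5.1 (2) condition "χ_d(−N) = 1"] -/
theorem sign_mul_jacobiSym_conductorNorm_curve243a1 {d : ℤ} (hd0 : 0 < d) (hd12 : d % 12 = 1) :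
    Int.sign d * jacobiSym (curve243a1.conductorNorm ℤ) d.natAbs = 1 := by
  obtain ⟨k, -, hk⟩ := conductorNorm_curve243a1_eq_pow
  rw [hk, Int.sign_eq_one_of_pos hd0, one_mul, Nat.cast_pow, Nat.cast_ofNat, jacobiSym.pow_left]
  have hn : (d.natAbs : ℤ) = d := Int.natAbs_of_nonneg hd0.le
  have hn4 : d.natAbs % 4 = 1 := by omega
  have hn3 : (d.natAbs : ℤ) % ((3 : ℕ) : ℤ) = 1 % ((3 : ℕ) : ℤ) := by
    change (d.natAbs : ℤ) % 3 = 1 % 3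
    omega
  have h3 : jacobiSym 3 d.natAbs = 1 := by
    have hrec := jacobiSym.quadratic_reciprocity_one_mod_four' (a := 3) (b := d.natAbs) (by decide) hn4
    rw [Nat.cast_ofNat] at hrec
    rw [hrec, jacobiSym.mod_left, hn3, ← jacobiSym.mod_left, jacobiSym.one_left]
  rw [h3, one_pow]

end Summit.BirchSwinnertonDyer.Rank1Residual.P2
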